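import Literature.Probability.LatticeModels.LupuCouplingTwoPointDecay
import Literature.Probability.LatticeModels.DiscreteGFFLawUniqueness
import Literature.Probability.Percolation.UniquenessInfiniteCluster
import HarnessLib

/-!
# Lupu's coupling: the annealed bond model on the joint space `(φ, U)`

Topic `Literature/Probability/LatticeModels`. Brick 9 of the proof of
`Literature.Probability.LatticeModels.Lupu2016_cableSignClustersBounded` (Lupu 2016, Prop. 5.5).
The dependent percolation model `ω` of Lupu's §5 (the trace on `ℤ^d` of the sign clusters of
the cable-system free field) is realised on the product space
`(ℤ^d → ℝ) × (Sym2 ℤ^d → ℝ)` with law `jointMeasure ν = ν ⊗ Leb_{[0,1]}^{⊗}` (`ν` the free-field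
law, i.i.d. uniform labels `U`, the tree's `labelMeasure`): `ω = symConfig φ U = {e | U_e ≤
symWeight φ e}`, so that conditionally on `φ` the bonds are independent with Lupu's weights
(`labelMeasure_symConfig_preimage`: the conditional law is `prodBernoulli (symWeight φ)`), and the
positive-side configuration of the fact, `posConfig φ U = {e | U_e ≤ lupuWeight φ e}`, is a
sub-configuration (`posConfig_subset_symConfig`). Contents (all proved):

* `annealedLaw ν` (the law `μ̄` of `ω`) and its disintegration
  `μ̄(B) = ∫ P_φ(B) ν(dφ)` (`annealedLaw_apply`); `μ̄`-a.s. only lattice bonds are open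
  (`annealedLaw_not_subset_edgeSet`);
* **translation invariance** `μ̄(S + v) = μ̄(S)` (`annealedLaw_preimage_shift`, from the
  translation invariance of the free field `IsDiscreteGFF.map_shift_eq` and of the i.i.d. labels)
  — the "translation invariance" in Lupu's Lemma 5.3;
* **Cameron–Martin quasi-invariance** of the free field under shifts by `t · 1_K`, `K` finite
  (`map_add_boxShift_absolutelyContinuous`, iterating the one-site identity
  `IsInnovationSite.lintegral_comp_add_single`) — our substitute for the "positive finite energy"
  of Lupu's Lemma 5.3: it lets one force the field to be large of a given sign on a box;
* sign bookkeeping: if all labels are positive, open bonds join sites with `φ_x φ_y > 0`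
  (`reachable_symConfig_mul_pos`: clusters are sign-monochromatic) and `ω ⊆ E(ℤ^d)`.

References: T. Lupu, Ann. Probab. 44 (2016), §5, Lemma 5.3 and Prop. 5.5 [`Lupu2016`].
-/

noncomputable section

namespace Literature.Probability.LatticeModels

open _root_.MeasureTheory _root_.ProbabilityTheory Finset Filter Literature.Probability.Percolation
open scoped ENNReal NNReal

variable {d : ℕ}

/-! ### Configurations from a field and labels -/

/-- The i.i.d. uniform labels `(U_e)_{e ∈ Sym2 ℤ^d}`. [folklore] -/
abbrev Labels (d : ℕ) : Type := Sym2 (Site d) → ℝ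

/-- **The bond configuration of Lupu's (symmetric) coupling** read off the field `φ` and the labels
`U`: `e` is open iff `U_e ≤ symWeight φ e = 1 - e^{-2(φ_x φ_y)⁺}` (Lupu 2016, Thm. 1 bis: given the
field, the edges are opened independently with these probabilities). [cite: Lupu2016, Thm. 1 bis] -/
def symConfig (φ : Site d → ℝ) (U : Labels d) : BondConfig (Site d) :=
  {e | U e ≤ (symWeight φ e : ℝ)}

/-- The positive-side configuration of the fact: `e` open iff `U_e ≤ lupuWeight φ e`.
[cite: Lupu2016, Cor. 3.6] -/
def posConfig (φ : Site d → ℝ) (U : Labels d) : BondConfig (Site d) :=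
  {e | U e ≤ (lupuWeight φ e : ℝ)}

/-- The positive-side configuration is contained in the symmetric one (`lupuWeight ≤ symWeight`).
[cite: Lupu2016, Thm. 1 bis] -/
theorem posConfig_subset_symConfig (φ : Site d → ℝ) (U : Labels d) :
    posConfig φ U ⊆ symConfig φ U :=
  fun e (he : U e ≤ _) => he.trans (Subtype.coe_le_coe.2 (lupuWeight_le_symWeight φ e))

/-- `(φ, U) ↦ symConfig φ U` is measurable. [folklore] -/
theorem measurable_symConfig :
    Measurable fun p : (Site d → ℝ) × Labels d => symConfig p.1 p.2 := by
  refine measurable_set_iff.2 fun e => ?_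
  change Measurable fun p : (Site d → ℝ) × Labels d => p.2 e ≤ (symWeight p.1 e : ℝ)
  refine measurableSet_setOf.1 (measurableSet_le ((measurable_pi_apply e).comp measurable_snd) ?_)
  exact (continuous_coe_symWeight e).measurable.comp measurable_fst

/-- `(φ, U) ↦ posConfig φ U` is measurable. [folklore] -/
theorem measurable_posConfig :
    Measurable fun p : (Site d → ℝ) × Labels d => posConfig p.1 p.2 := by
  refine measurable_set_iff.2 fun e => ?_
  change Measurable fun p : (Site d → ℝ) × Labels d => p.2 e ≤ (lupuWeight p.1 e : ℝ)
  refine measurableSet_setOf.1 (measurableSet_le ((measurable_pi_apply e).comp measurable_snd) ?_)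
  have : Measurable fun φ : Site d → ℝ => (lupuWeight φ e : ℝ) := by
    induction e using Sym2.ind with
    | _ x y =>
      by_cases he : s(x, y) ∈ (zdGraph d).edgeSet
      · simp_rw [coe_lupuWeight_of_adj _ ((SimpleGraph.mem_edgeSet _).1 he)]
        fun_prop
      · simp_rw [lupuWeight_of_not_mem _ he]; exact measurable_const
  exact this.comp measurable_fst

/-- For a fixed field `φ`, `U ↦ symConfig φ U` is measurable. [folklore] -/
theorem measurable_symConfig_right (φ : Site d → ℝ) : Measurable (symConfig φ) :=
  measurable_symConfig.comp (measurable_const.prodMk measurable_id)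

/-- **Conditionally on the field the bonds are independent with Lupu's weights**: under the label
measure, `symConfig φ ·` has law `prodBernoulli (symWeight φ)` (the tree's monotone coupling
`prodBernoulli_eq_map_labels`). [cite: Lupu2016, Thm. 1 bis] -/
theorem labelMeasure_symConfig_preimage (φ : Site d → ℝ) {B : Set (BondConfig (Site d))}
    (hB : MeasurableSet B) :
    labelMeasure (Site d) {U | symConfig φ U ∈ B} = prodBernoulli (symWeight φ) B := by
  have hm : Measurable fun U : Labels d => {i | U i ≤ (symWeight φ i : ℝ)} :=
    measurable_symConfig_right φ
  rw [prodBernoulli_eq_map_labels, Measure.map_apply hm hB]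
  rfl

/-- The same for the positive-side configuration and `prodBernoulli (lupuWeight φ)`.
[cite: Lupu2016, Cor. 3.6] -/
theorem labelMeasure_posConfig_preimage (φ : Site d → ℝ) {B : Set (BondConfig (Site d))}
    (hB : MeasurableSet B) :
    labelMeasure (Site d) {U | posConfig φ U ∈ B} = prodBernoulli (lupuWeight φ) B := by
  have hm : Measurable fun U : Labels d => {i | U i ≤ (lupuWeight φ i : ℝ)} :=
    measurable_posConfig.comp (measurable_const.prodMk measurable_id)
  rw [prodBernoulli_eq_map_labels, Measure.map_apply hm hB]
  rfl

/-! ### The joint measure and the annealed law -/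

/-- The joint law of the field and the labels: `ν ⊗ Leb_{[0,1]}^{⊗ Sym2 ℤ^d}`. [folklore] -/
def jointMeasure (ν : Measure (Site d → ℝ)) : Measure ((Site d → ℝ) × Labels d) :=
  ν.prod (labelMeasure (Site d))

/-- The **annealed law** `μ̄` of Lupu's bond configuration: the law of `symConfig φ U` under the
joint measure. [cite: Lupu2016, §5 (the configuration ω)] -/
def annealedLaw (ν : Measure (Site d → ℝ)) : Measure (BondConfig (Site d)) :=
  (jointMeasure ν).map fun p => symConfig p.1 p.2

/-- The joint measure is a probability measure. [folklore] -/
instance instIsProbabilityMeasureJointMeasure (ν : Measure (Site d → ℝ)) [IsProbabilityMeasure ν] :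
    IsProbabilityMeasure (jointMeasure ν) := by
  have := isProbabilityMeasure_labelMeasure (Site d)
  unfold jointMeasure; infer_instance

/-- The annealed law is a probability measure. [folklore] -/
instance instIsProbabilityMeasureAnnealedLaw (ν : Measure (Site d → ℝ)) [IsProbabilityMeasure ν] :
    IsProbabilityMeasure (annealedLaw ν) :=
  Measure.isProbabilityMeasure_map measurable_symConfig.aemeasurable

/-- **Disintegration of the annealed law**: `μ̄(B) = ∫ P_φ(B) ν(dφ)`. [folklore] -/
theorem annealedLaw_apply (ν : Measure (Site d → ℝ)) [SFinite ν] {B : Set (BondConfig (Site d))}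
    (hB : MeasurableSet B) :
    annealedLaw ν B = ∫⁻ φ, prodBernoulli (symWeight φ) B ∂ν := by
  have := isProbabilityMeasure_labelMeasure (Site d)
  rw [annealedLaw, Measure.map_apply measurable_symConfig hB, jointMeasure,
    Measure.prod_apply (measurable_symConfig hB)]
  refine lintegral_congr fun φ => ?_
  exact labelMeasure_symConfig_preimage φ hB

/-- The joint measure of a `symConfig`-preimage, as an integral of conditional probabilities.
[folklore] -/
theorem jointMeasure_preimage_symConfig (ν : Measure (Site d → ℝ)) [SFinite ν]
    {B : Set (BondConfig (Site d))} (hB : MeasurableSet B) :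
    jointMeasure ν {p | symConfig p.1 p.2 ∈ B} = ∫⁻ φ, prodBernoulli (symWeight φ) B ∂ν := by
  rw [← annealedLaw_apply ν hB, annealedLaw, Measure.map_apply measurable_symConfig hB]
  rfl

/-- **`μ̄`-almost surely only lattice bonds are open.** [folklore] -/
theorem annealedLaw_not_subset_edgeSet (ν : Measure (Site d → ℝ)) [SFinite ν] :
    annealedLaw ν {ω | ¬ ω ⊆ (zdGraph d).edgeSet} = 0 := by
  have hmeas : MeasurableSet {ω : BondConfig (Site d) | ¬ ω ⊆ (zdGraph d).edgeSet} := by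
    have : {ω : BondConfig (Site d) | ¬ ω ⊆ (zdGraph d).edgeSet} =
        {ω | ∀ e ∈ (zdGraph d).edgeSetᶜ, e ∉ ω}ᶜ := by
      ext ω
      simp only [Set.mem_setOf_eq, Set.mem_compl_iff, Set.not_subset]
      constructor
      · rintro ⟨e, he, heE⟩ h; exact h e heE he
      · intro h; by_contra h'; push Not at h'; exact h fun e heE heω => heE (h' e heω)
    rw [this]
    exact (measurableSet_forall_notMem_of_countable (Set.to_countable _)).compl
  rw [annealedLaw_apply ν hmeas]
  simp [prodBernoulli_symWeight_not_subset_edgeSet]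

/-- `μ̄`-a.s. `ω ⊆ E(ℤ^d)`. [folklore] -/
theorem ae_subset_edgeSet_annealedLaw (ν : Measure (Site d → ℝ)) [SFinite ν] :
    ∀ᵐ ω ∂annealedLaw ν, ω ⊆ (zdGraph d).edgeSet := by
  rw [ae_iff]
  exact annealedLaw_not_subset_edgeSet ν

/-! ### Translation invariance -/

/-- The symmetric weights are translation covariant: the weights of the translated field
`φ(· - v)` are the weights of `φ` at the translated bonds. [folklore] -/
theorem symWeight_shift (φ : Site d → ℝ) (v : Site d) (e : Sym2 (Site d)) :
    symWeight (fun x => φ (x + -v)) e = symWeight φ ((sym2Equiv (Site.shift v)).symm e) := by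
  rw [coe_sym2Equiv_shift_symm]
  induction e using Sym2.ind with
  | _ a b =>
    have hadj : (zdGraph d).Adj (a + -v) (b + -v) ↔ (zdGraph d).Adj a b :=
      zdGraph_adj_shift_iff (-v) a b
    simp only [symWeight, Sym2.map_mk, Sym2.mul_mk, SimpleGraph.mem_edgeSet, hadj]

/-- The joint transformation "translate the field and the labels by `v`". [folklore] -/
def jointShift (v : Site d) (p : (Site d → ℝ) × Labels d) : (Site d → ℝ) × Labels d :=
  (fun x => p.1 (x + -v), fun e => p.2 ((sym2Equiv (Site.shift v)).symm e))

/-- Translating field and labels translates the configuration. [folklore] -/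
theorem symConfig_jointShift (v : Site d) (p : (Site d → ℝ) × Labels d) :
    symConfig (jointShift v p).1 (jointShift v p).2 =
      BondConfig.relabel (sym2Equiv (Site.shift v)) (symConfig p.1 p.2) := by
  ext e
  rw [BondConfig.mem_relabel_iff]
  simp only [symConfig, jointShift, Set.mem_setOf_eq, symWeight_shift]

/-- `jointShift v` is measurable. [folklore] -/
theorem measurable_jointShift (v : Site d) : Measurable (jointShift (d := d) v) :=
  (measurable_pi_lambda _ fun x => (measurable_pi_apply (x + -v)).comp measurable_fst).prodMk
    (measurable_pi_lambda _ fun e =>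
      (measurable_pi_apply ((sym2Equiv (Site.shift v)).symm e)).comp measurable_snd)

/-- The i.i.d. labels are invariant under relabelling by a bijection of the bonds. [folklore] -/
theorem labelMeasure_map_comp_equiv (σ : Sym2 (Site d) ≃ Sym2 (Site d)) :
    (labelMeasure (Site d)).map (fun U : Labels d => fun e => U (σ.symm e)) = labelMeasure (Site d) := by
  have : IsProbabilityMeasure ((volume : Measure ℝ).restrict (Set.Icc (0 : ℝ) 1)) :=
    isProbabilityMeasure_volume_restrict_unitInterval
  have h := Measure.infinitePi_map_piCongrLeft (fun _ : Sym2 (Site d) => (volume : Measure ℝ).restrict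
    (Set.Icc (0 : ℝ) 1)) σ
  have hfun : (fun U : Labels d => fun e => U (σ.symm e)) =
      ⇑(MeasurableEquiv.piCongrLeft (fun _ : Sym2 (Site d) => ℝ) σ) := by
    funext U; funext e
    simp [MeasurableEquiv.coe_piCongrLeft, Equiv.piCongrLeft_apply_eq_cast]
  rw [hfun]
  exact h

/-- **The joint measure is translation invariant** (free field: `IsDiscreteGFF.map_shift_eq`;
labels: product measure). [cite: Lupu2016, Lemma 5.3 (translation invariance)] -/
theorem jointMeasure_map_jointShift {ν : Measure (Site d → ℝ)} (hν : IsDiscreteGFF ν (coordProc d))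
    (v : Site d) : (jointMeasure ν).map (jointShift v) = jointMeasure ν := by
  have hP := hν.1.isProbabilityMeasure
  have := isProbabilityMeasure_labelMeasure (Site d)
  have hf : Measurable fun (φ : Site d → ℝ) (x : Site d) => φ (x + -v) :=
    measurable_pi_lambda _ fun x => measurable_pi_apply (x + -v)
  have hg : Measurable fun (U : Labels d) (e : Sym2 (Site d)) => U ((sym2Equiv (Site.shift v)).symm e) :=
    measurable_pi_lambda _ fun e => measurable_pi_apply _
  have hprod : jointShift (d := d) v = Prod.map (fun (φ : Site d → ℝ) (x : Site d) => φ (x + -v))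
      (fun (U : Labels d) (e : Sym2 (Site d)) => U ((sym2Equiv (Site.shift v)).symm e)) := rfl
  rw [jointMeasure, hprod, ← Measure.map_prod_map _ _ hf hg, hν.map_shift_eq (-v),
    labelMeasure_map_comp_equiv]

/-- **Translation invariance of the annealed law**: `μ̄(ω ↦ ω + v ∈ S) = μ̄(S)` for every event `S`.
[cite: Lupu2016, Lemma 5.3 (translation invariance)] -/
theorem annealedLaw_preimage_shift {ν : Measure (Site d → ℝ)} (hν : IsDiscreteGFF ν (coordProc d))
    (v : Site d) {S : Set (BondConfig (Site d))} (hS : MeasurableSet S) :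
    annealedLaw ν (BondConfig.relabel (sym2Equiv (Site.shift v)) ⁻¹' S) = annealedLaw ν S := by
  have hS' : MeasurableSet (BondConfig.relabel (sym2Equiv (Site.shift v)) ⁻¹' S) :=
    (BondConfig.relabel _).measurable hS
  rw [annealedLaw, Measure.map_apply measurable_symConfig hS', Measure.map_apply measurable_symConfig hS]
  have hset : (fun p : (Site d → ℝ) × Labels d => symConfig p.1 p.2) ⁻¹'
      (BondConfig.relabel (sym2Equiv (Site.shift v)) ⁻¹' S) =
      jointShift v ⁻¹' ((fun p : (Site d → ℝ) × Labels d => symConfig p.1 p.2) ⁻¹' S) := by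
    ext p
    simp only [Set.mem_preimage, ← symConfig_jointShift]
  rw [hset, ← Measure.map_apply (measurable_jointShift v) (measurable_symConfig hS),
    jointMeasure_map_jointShift hν v]

/-! ### Cameron–Martin quasi-invariance under finitely supported shifts -/

namespace IsDiscreteGFF

variable {ν : Measure (Site d → ℝ)}

/-- **Shifting the free field at one site is absolutely continuous**:
`ν ∘ (φ ↦ φ + t e_u)⁻¹ ≪ ν` (the density is `exp(2dt ζ_u - d t²)`,
`IsInnovationSite.lintegral_comp_add_single`). [folklore] -/
theorem map_add_single_absolutelyContinuous (hν : IsDiscreteGFF ν (coordProc d)) (hd : 3 ≤ d)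
    (u : Site d) (t : ℝ) :
    ν.map (fun φ : Site d → ℝ => φ + Pi.single u t) ≪ ν := by
  have h := hν.isInnovationSite_coord hd u
  refine Measure.AbsolutelyContinuous.mk fun B hB hB0 => ?_
  rw [Measure.map_apply (measurable_add_const _) hB, ← lintegral_indicator_one
    ((measurable_add_const _) hB)]
  have h1 : ∫⁻ φ, ((fun φ : Site d → ℝ => φ + Pi.single u t) ⁻¹' B).indicator
      (1 : (Site d → ℝ) → ℝ≥0∞) φ ∂ν =
      ∫⁻ φ, B.indicator (1 : (Site d → ℝ) → ℝ≥0∞) ((coordProc d · φ) + Pi.single u t) ∂ν :=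
    lintegral_congr fun φ => rfl
  rw [h1, h.lintegral_comp_add_single (by omega) (measurable_one.indicator hB) t]
  have h2 : ∀ φ : Site d → ℝ, B.indicator (1 : (Site d → ℝ) → ℝ≥0∞) (coordProc d · φ) *
      ENNReal.ofReal (Real.exp (2 * d * t * siteInnovation (coordProc d · φ) u - d * t ^ 2)) =
      B.indicator (fun φ => ENNReal.ofReal
        (Real.exp (2 * d * t * siteInnovation (coordProc d · φ) u - d * t ^ 2))) φ := by
    intro φ
    by_cases hφ : φ ∈ B
    · simp [Set.indicator_of_mem hφ, coordProc]
    · simp [Set.indicator_of_notMem hφ, coordProc]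
  simp_rw [h2]
  rw [lintegral_indicator hB, Measure.restrict_eq_zero.2 hB0, lintegral_zero_measure]

/-- The shift by `t` on the finite set `K`: `t · 1_K`. [folklore] -/
def boxShift (K : Finset (Site d)) (t : ℝ) : Site d → ℝ := fun x => if x ∈ K then t else 0

/-- `t·1_{insert u K} = t·1_K + t e_u` for `u ∉ K`. [folklore] -/
theorem boxShift_insert {K : Finset (Site d)} {u : Site d} (hu : u ∉ K) (t : ℝ) :
    boxShift (insert u K) t = boxShift K t + Pi.single u t := by
  funext x
  by_cases hx : x = u
  · subst hx; simp [boxShift, hu]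
  · simp [boxShift, hx]

/-- **Cameron–Martin quasi-invariance on a finite set** (`d ≥ 3`): `ν ∘ (φ ↦ φ + t·1_K)⁻¹ ≪ ν`,
by induction on `K` from the one-site case. This is how we make the free field large of a given
sign on a box with positive probability (our replacement for the "positive finite energy" of
Lupu 2016, Lemma 5.3). [cite: Lupu2016, Lemma 5.3] -/
theorem map_add_boxShift_absolutelyContinuous (hν : IsDiscreteGFF ν (coordProc d)) (hd : 3 ≤ d)
    (K : Finset (Site d)) (t : ℝ) :
    ν.map (fun φ : Site d → ℝ => φ + boxShift K t) ≪ ν := by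
  classical
  induction K using Finset.induction_on with
  | empty =>
    have : (fun φ : Site d → ℝ => φ + boxShift ∅ t) = id := by
      funext φ; funext x; simp [boxShift]
    rw [this, Measure.map_id]
  | @insert u K hu ih =>
    have hcomp : (fun φ : Site d → ℝ => φ + boxShift (insert u K) t) =
        (fun φ : Site d → ℝ => φ + boxShift K t) ∘ fun φ => φ + Pi.single u t := by
      funext φ
      simp only [Function.comp_apply, boxShift_insert hu]
      abel
    rw [hcomp, ← Measure.map_map (measurable_add_const _) (measurable_add_const _)]
    exact ((hν.map_add_single_absolutelyContinuous hd u t).map (measurable_add_const _)).trans ih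

end IsDiscreteGFF

/-! ### Signs along open paths -/

/-- With positive labels, an open bond has endpoints of the same strict sign. [cite: Lupu2016, Thm. 1 bis] -/
theorem mul_pos_of_mem_symConfig {φ : Site d → ℝ} {U : Labels d} (hU : ∀ e, 0 < U e) {a b : Site d}
    (h : s(a, b) ∈ symConfig φ U) : 0 < φ a * φ b := by
  by_contra hle
  push Not at hle
  have h0 := symWeight_eq_zero_of_mul_nonpos φ hle
  have : U s(a, b) ≤ 0 := by
    have h' : U s(a, b) ≤ (symWeight φ s(a, b) : ℝ) := h
    rw [h0] at h'; exact h'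
  exact absurd (hU s(a, b)) (not_lt.2 this)

/-- With positive labels only lattice bonds are open. [folklore] -/
theorem symConfig_subset_edgeSet {φ : Site d → ℝ} {U : Labels d} (hU : ∀ e, 0 < U e) :
    symConfig φ U ⊆ (zdGraph d).edgeSet := by
  intro e he
  by_contra hE
  have h0 := symWeight_of_not_mem φ hE
  have h' : U e ≤ (symWeight φ e : ℝ) := he
  rw [h0] at h'
  exact absurd (hU e) (not_lt.2 h')

/-- **Clusters are sign-monochromatic**: with positive labels, if `x` is joined to `y` by an open
path and `φ_x ≠ 0` then `φ_x φ_y > 0`. [cite: Lupu2016, Thm. 1 bis] -/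
theorem reachable_symConfig_mul_pos {φ : Site d → ℝ} {U : Labels d} (hU : ∀ e, 0 < U e) {x y : Site d}
    (h : (openGraph (symConfig φ U)).Reachable x y) (hx : φ x ≠ 0) : 0 < φ x * φ y := by
  obtain ⟨p⟩ := h
  induction p with
  | nil => exact mul_self_pos.2 hx
  | @cons a b c hab p ih =>
    rw [openGraph_adj] at hab
    have h1 : 0 < φ a * φ b := mul_pos_of_mem_symConfig hU hab.1
    have hb : φ b ≠ 0 := fun h0 => by rw [h0, mul_zero] at h1; exact lt_irrefl _ h1
    have h2 : 0 < φ b * φ c := ih hb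
    have h3 : 0 < (φ a * φ b) * (φ b * φ c) := mul_pos h1 h2
    have hbb : 0 < φ b * φ b := mul_self_pos.2 hb
    have key : (φ a * φ b) * (φ b * φ c) = (φ a * φ c) * (φ b * φ b) := by ring
    rw [key] at h3
    exact (pos_iff_pos_of_mul_pos h3).2 hbb

end Literature.Probability.LatticeModels
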